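import Summits.QuantumFields.YangMills.Theorems.BalabanUVNodesN16N05UniformPAWB16RowsOfReg910Slot

/-!
# Route «BalabanUVNodes», crux K3⁸ `SpineGivenEndpointR13SepCoPHV` (stmt-QuantumFields-27366), node N16 = NE3 — THE TOP KNIT ON THE N16 ∕ N27 SEAM AT node00's RE-KEYED DICTIONARY:
# THE K3⁸ BILLS' ELEVEN N16 BINDER TEXTS (module 54A's rows, `N = 2`) PRODUCED FROM NODE N05's Σ-OBJECT read AT `stage3OfFamily F` (FLAG №14 T1: 𝔸 = M₂(ℂ); the θ of the K1⁹ face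
# of record) + node N07's slot key — module 59g transported along `stage3OfFamilyMat F 2 = stage3OfFamily F` (`rfl`)

Cell `pub-ymgap`, seat `pub-ymgap-dag-n16-e` (R134 acceleration seat (a), strategy s2 = BY-NAME KNIT at the record; HUMAN RULING D-0062; chair R424 venue), generation 24,
module 59i (ONE THEOREM, 0 `def`, 0 `sorry`, standard axioms; Theses-free, importable).  `--kind proof --supports stmt-QuantumFields-27366 --as helper` (count-neutral; proves NO
registered stub).  `bears_on: R4∕N16 · edges N05 → N16, N07 → N16 · composite N27`.

WHY (HOME `HANDOFF.md` §g24 t7; FLAG №14 cure road).  Module 59g (p691995) produces the K3⁸ bills' eleven N16 rows from node N05's Σ-object displayed at this seat's matrix-valued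
dictionary `stage3OfFamilyMat F 2` (minted while node00's `stage3OfFamily F` had `𝔸 := ℂ`).  node00-def-RR-2's T1 (p694656) re-keyed the record to `𝔸 := Matrix (Fin 2) (Fin 2) ℂ`
with this seat's instance term, so `stage3OfFamilyMat F 2 = stage3OfFamily F` by `rfl` (module 58 v1.2).  THIS MODULE is module 59g with `hN05` displayed AT `stage3OfFamily F` — the θ
at which the K1⁹ face of record (dag-n24-c's junction files and their №14 T0(β) editions) displays node N05 ∕ N06 — so ONE N05 object serves the K1⁹ junction and the K3⁸ bills' N16 rows
BY NAME; proof = module 59g applied to the displayed hypothesis (definitional transport).  A K3⁸ composer holding node N05's object at `stage3OfFamily F` (node N06's per-period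
binders there, through p681888 with node00's `finiteDimensional_𝔸_stage3OfFamily` for its instance argument) and the slot key does ONE `obtain` here.

WHAT IS PROVED ([folklore] composition BY NAME; no estimate).  ★★ `exists_letters_awb16Rows_of_n05UniformP_familyDict_reg910Slot`.

HONEST FRAMING.  Composition BY NAME; no estimate.  `hN05` (node N05's Σ-object — [Balaban1985RegularSpaces] Thm 4 ∕ Prop 3 BODIES, one threshold pair, every print-class
periodic member of every period) and the slot key (node N07 — [Balaban1985Variational] Thm 1 (9)–(10)) are DISPLAYED hypotheses asserted for no family; node N05's p681888 inhabits
`hN05 F` GIVEN node N06's binders at `stage3OfFamilyMat F 2` (N06 content, NOT discharged; the tree's N06 object layer of record sits at `stage3OfFamily F`, `𝔸 = ℂ`); no stub of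
K3⁸ v7 closed or claimed; N16 ∕ N05 ∕ N06 ∕ N07 ∕ N27 NOT discharged; counts UNMOVED (typed 28∕28 · discharged 8∕27 · A 8∕28).  One finite four-torus at fixed `ε`, Bałaban AS
PRINTED — NOT ℝ⁴, NOT infinite volume, NOT OS, NOT a mass gap; the YM mass gap (Clay) is NOT proved by any of this — R4 closes the conditional finite-𝕋⁴ rung `BalabanLadder.UV` only.
References: [Balaban1985Variational] T. Bałaban, CMP **102** (1985) 277–309, Thm 1 p. 279; [Balaban1985RegularSpaces] T. Bałaban, CMP **99** (1985) 75–102, pp. 87–88.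
-/

set_option autoImplicit false

namespace Summit.QuantumFields.YangMills.BalabanUVNodes.N16N05UniformPFamilyDictAWB16RowsOfReg910Slot

open scoped BigOperators Matrix Matrix.Norms.L2Operator
open NormedSpace

open Literature.MathematicalPhysics.QuantumFieldTheory.Balaban1983to89
open Literature.MathematicalPhysics.QuantumFieldTheory.Balaban1983to89.T4Continuum (T4Family ULoop)
open B7Prop1Explicit B7Prop2Explicit MatrixLog UnitaryModel
open T4AveragingDeficitWall hiding Site Plane Plaq Bond
open B8LeafModelZdHP2Per (zdGF3HP₂Per)
open Node00 (Stage13HParams IdxB8SubDPerκ NE3Objects₁₁ NE3Letters₁₁ ne3ConstLayerOfRecord₁₁ ne3NperOfRecord₁₁ ne3DomOfRecord₁₁ MatA stage3OfFamily)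
open Summit.QuantumFields.BalabanUV.T4Continuum
open MinimalActionSandwich (IsMinimiser admissible)
open Summit.QuantumFields.YangMills.BalabanUVNodes.N16HolderDefs (N16HolderAt)
open Summit.QuantumFields.YangMills.BalabanUVNodes.N16PinnedLayer13CoPH (N16PinnedLoose N16LettersEnd N16HolderAtReading)
open Summit.QuantumFields.YangMills.BalabanUVNodes.N16N05UniformPAWB16RowsOfReg910Slot (exists_letters_awb16Rows_of_n05UniformP_reg910Slot)
open YMDAG.N14.TopBorn (ne1OfRecord)
open MinimalActionRate (sfClass)
open MinimalActionRefine (gradConst)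
open NE3.LeafIndexSockets (LeafH3sup)
open YMDAG.UVSplit (ne3OfRecord₁₁ RateReading₁₃CoPH)

noncomputable section
variable {β : ℝ}

/-- **★★ THE ADAPTER FED FROM NODE N05's Σ-OBJECT — MWBNⱽ ∕ AWB16ⱽ's ELEVEN N16 BINDER TEXTS FROM `hN05` (node N05's p681888 conclusion text AT node00's RE-KEYED DICTIONARY OF THE FAMILY `stage3OfFamily F`, 𝔸 = M₂(ℂ) since FLAG №14 T1 p694656 — the θ of the K1⁹ face of record) + THE SLOT KEY** (module 59g transported along `stage3OfFamilyMat F 2 = stage3OfFamily F`, `rfl`).  From node N16's chain-entry object `hE` at exponent `β ∈ [0, 1]` and node N07's slot key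
(`G hGm hG C hR`, module 53's binders at `N = 2`): letters `ℓ₃ g B c' ρ c` with `hend`, `hmatch`, the floor, `hradii`, `hclass`, the family-level `h16`, `hloose`, `hρε`,
`hρb`, `hc` (p646044's binder texts VERBATIM) and the junction range rows.  Module 53 §2 re-lettered (`g := gradConst 4 ∘ c'`, `ρ := B₃·(ε∕B)`, `c := 16937·ρ`); `h16`
through module 43's face at a reading minted pinned loose at `(ℓ₃, B)`. [cite: Balaban1985Variational, Thm 1 (9)–(10) p.279] [folklore] -/
theorem exists_letters_awb16Rows_of_n05UniformP_familyDict_reg910Slot (hβ0 : 0 ≤ β) (hβ1 : β ≤ 1)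
    (hN05 : ∀ F : T4Family, letI : CStarAlgebra (Matrix (Fin 2) (Fin 2) ℂ) := B10Eq29TubeLine.cstarAlgebraMatrix 2
      ∃ (Mκ Rκ : ℕ) (len : B7Prop1Explicit.Site 4 → ℝ), (∀ v : B7Prop1Explicit.Site 4, 0 < len v → 1 ≤ len v) ∧ (∀ μ : Fin 4, len (B7Prop1Explicit.e μ) = 1) ∧
      ∃ (inp : B8.B9Inputs) (B₀β B₈ c₄ c₃ : ℝ), inp.B₀ ≤ B₈ ∧ 0 < c₄ ∧ 0 < c₃ ∧
        ∀ (ν : {k : ℕ // 1 ≤ k}) (a : IdxB8SubDPerκ (stage3OfFamily F) (ne3NperOfRecord₁₁ F 0 0 * F.L ^ ν.1) Mκ Rκ),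
          B8.Thm4Body c₄ (5 * ((4 : ℕ) : ℝ) * F.L * B₈)
            (fun _ : Unit => (zdGF3HP₂Per (Matrix (Fin 2) (Fin 2) ℂ) F.L β len a.toZdIdx (ne3NperOfRecord₁₁ F 0 0 * F.L ^ ν.1)).toGFData) ∧
          B8.Prop3Body c₃ 4 (F.L : ℝ) (2097152 * (((4 : ℕ) : ℝ) + 1) ^ 2 * (F.L : ℝ) ^ 2) inp B₀β
            (fun _ : Unit => (zdGF3HP₂Per (Matrix (Fin 2) (Fin 2) ℂ) F.L β len a.toZdIdx (ne3NperOfRecord₁₁ F 0 0 * F.L ^ ν.1)).toGFData2))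
    {G : T4Family → (B7Prop1Explicit.Site 4 → Fin 4 → (Node00.MatA 2)ˣ) → B7Prop1Explicit.Site 4 → ℕ → ℝ → ℝ → ℝ → Prop}
    (hGm : ∀ F, MinimalActionDictionary.RadiiMono 4 (G F))
    (hG : ∀ (F : T4Family) (U : B7Prop1Explicit.Site 4 → Fin 4 → (Node00.MatA 2)ˣ) (x : B7Prop1Explicit.Site 4) (K : ℕ) (α₀ α₁ α₂ : ℝ), 2 ≤ K → G F U x K α₀ α₁ α₂ →
      ∃ (u : B7Prop1Explicit.Site 4 → (Node00.MatA 2)ˣ) (a : B7Prop1Explicit.Site 4 → Fin 4 → Node00.MatA 2),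
        (∀ z, u z ∈ B7Prop2Explicit.unitaryUnits (Node00.MatA 2)) ∧
        (∀ (y : B7Prop1Explicit.Site 4) (τ : Fin 4), B7Prop1Explicit.l1 (y - x) ≤ 2 →
          ((B7Prop1Explicit.gaugeAct u U y τ : (Node00.MatA 2)ˣ) : Node00.MatA 2) = NormedSpace.exp (a y τ)) ∧
        (∀ (y : B7Prop1Explicit.Site 4) (τ : Fin 4), B7Prop1Explicit.l1 (y - x) ≤ 2 → ‖a y τ‖ ≤ α₀) ∧
        (∀ (y : B7Prop1Explicit.Site 4) (τ i : Fin 4), B7Prop1Explicit.l1 (y - x) ≤ 1 → ‖AveragingDeficitLatticeH2Prep.fd i (fun z => a z τ) y‖ ≤ α₁) ∧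
        (∀ (τ i l : Fin 4), ‖AveragingDeficitLatticeH2Prep.fd i (AveragingDeficitLatticeH2Prep.fd l (fun z => a z τ)) x‖ ≤ α₂))
    (C : T4Family → B11Thm1.Consts)
    (hR : ∀ (F : T4Family) (k : ℕ) (ε₁ : ℝ), 0 < ε₁ → ε₁ ≤ (C F).a₁ → ∀ (V U : B7Prop1Explicit.Site 4 → Fin 4 → (Node00.MatA 2)ˣ),
      V ∈ sfClass 4 F.L (ne3NperOfRecord₁₁ F 0 0) ε₁ 0 →
      IsMinimiser 4 (sfClass 4 F.L (ne3NperOfRecord₁₁ F 0 0) ((C F).B₃ * ε₁)) F.L (ne3NperOfRecord₁₁ F 0 0) (k + 1) V U →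
        ∀ x : B7Prop1Explicit.Site 4, B11.Regularity (MinimalActionDictionary.torusVP 4 F.L (ne3NperOfRecord₁₁ F 0 0) (G F) (k + 1)) (C F).B₃ (C F).B₄ ε₁ U
          (x, F.L ^ (k + 1) - 1 + F.L ^ (k + 1) + 2)) :
    ∃ (ℓ₃ : T4Family → NE3Letters₁₁) (g B c' ρ c : T4Family → ℝ),
      N16LettersEnd 2 g ℓ₃ ∧
      (∀ F : T4Family, 0 < B F ∧ (ℓ₃ F).ε / B F ≤ (ℓ₃ F).b) ∧
      (∀ F : T4Family, (C F).B₃ ≤ B F ∧ (2 : ℝ) ^ 78 * (F.L : ℝ) ^ 12 ≤ B F) ∧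
      (∀ F : T4Family, (ℓ₃ F).g = gradConst 4 (c' F) ∧ 0 ≤ c' F ∧ 0 < c' F ∧ (ℓ₃ F).b ≤ c' F ∧
          (2 : ℝ) ^ 91 * (F.L : ℝ) ^ 17 * c' F ≤ 1 ∧ (2 : ℝ) ^ 76 * (F.L : ℝ) ^ 12 * c' F ≤ (ℓ₃ F).ε ∧ (ℓ₃ F).ε / B F ≤ 1 / 4 ∧ 4 * ((ℓ₃ F).ε / B F) ≤ c' F) ∧
      (∀ F : T4Family, 16 * B7Prop2Explicit.C0 4 * (ℓ₃ F).ε ≤ 3 ∧ 1024 * (4 + 1) * (4 + 4) * (F.L : ℝ) ^ 2 * (ℓ₃ F).ε ≤ 1) ∧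
      (∀ (F : T4Family), (∃ θ : Stage13HParams F 2, θ.Provisos₁₃CoPH F 2 ∧ (θ.ZhUnity F 2 ∧ θ.SlotsNondegenerate₁₃ F 2) ∧ θ.Admissible F 2) →
          N16HolderAt (ne3OfRecord₁₁ F { ne3ConstLayerOfRecord₁₁ F 2 (ℓ₃ F) with
            dom := {V | V ∈ ne3DomOfRecord₁₁ F 2 0 0 ∧ V ∈ sfClass 4 F.L (ne3NperOfRecord₁₁ F 0 0) ((ℓ₃ F).ε / B F) 0} }) β) ∧
      (∀ F : T4Family, LeafH3sup 4 F.L (ne3NperOfRecord₁₁ F 0 0) (ρ F) (ρ F) (c F)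
          ({V | V ∈ ne3DomOfRecord₁₁ F 2 0 0 ∧ V ∈ sfClass 4 F.L (ne3NperOfRecord₁₁ F 0 0) ((ℓ₃ F).ε / B F) 0} : Set (B7Prop1Explicit.Site 4 → Fin 4 → (Node00.MatA 2)ˣ))) ∧
      (∀ F : T4Family, ρ F ≤ (ℓ₃ F).ε) ∧
      (∀ F : T4Family, ρ F ≤ (ℓ₃ F).b) ∧
      (∀ F : T4Family, c F ≤ c' F) ∧
      (∀ F : T4Family, g F = gradConst 4 (c' F) ∧ ρ F = (C F).B₃ * ((ℓ₃ F).ε / B F) ∧ c F = 16937 * ρ F ∧ 0 < ρ F ∧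
        ρ F ≤ (C F).B₃ * (C F).a₁ ∧ ρ F ≤ 1 / 28) :=
  exists_letters_awb16Rows_of_n05UniformP_reg910Slot hβ0 hβ1 hN05 hGm hG C hR

end

end Summit.QuantumFields.YangMills.BalabanUVNodes.N16N05UniformPFamilyDictAWB16RowsOfReg910Slot
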